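import Summits.ABC.IUTFork.Repair.RH2SigmaHullRecutRows
import Summits.ABC.IUTFork.Repair.RHInSigmaDatum1627
import HarnessLib

/-!
# R-H ROUND 2, Q2 «S restricted to Σ», hull-reach family — row 16 BY NAME of abc-iut-rh2-xi-2's datum class `InSigma16` (p475213): the door at the
# certificates' bed with NO residual side condition, and its re-cut certificate (sequel of `Repair/RH2SigmaHullRecut.lean` / `…RecutRows.lean`)

PROOF-ONLY file (D-0012: 0 definitions, 0 `Prop` facts, no instance, no notation; abc-iut cell, rung LADDER-ABC:A2.RESCUE.H; seat abc-iut-rh2-q2-hull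
gen 2). TAKES NO SIDE on [IUTchIII] Cor. 3.12 or on any author; `InSigma16` (H⋆₁₆ `HStarDiffPriced` read on whole bad fibres: uniform tame different,
untied outer exponent) is a HYPOTHESIS SHAPE, never asserted; typed ≠ proved; instantiated ≠ endorsed; nothing here asserts abc.

This seat's row-16 door `pilotKummerCompatHull_chosen_of_hStarDiffPriced` (p472572) carries a side binder `hside` («every bad `w ∣ p`: `p` odd, ramification
uniform over `p`, `p ∤ e_w`, untied type»). abc-iut-rh2-xi-2 (gen 2, p475213 `Repair/RHInSigmaDatum1627.lean`) typed the datum class `InSigma16 D e_K B_K`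
that reads exactly these conditions fibre-wise and proved `InSigmaDatum.hside_of_inSigma16` («`InSigma16` ∧ bad primes odd ⟹ `hside`», in the `ramIdx`
currency). At the genuine bed the bad primes ARE odd — [IUTchI] Def. 3.1 (b) «of odd residue characteristic», in kernel
`Cor312Prov.ne_two_and_ne_l_of_placeOf_mem_S_pilotDataOfK` (abc-iut L5-t2's field `InitialThetaData.VbadMod_odd`) — so:

* `pilotKummerCompatHull_chosen_of_inSigma16` — «`InSigma16 D e_K B_K` ALONE ⟹ the BODY of `hSHw` at the certificates' bed» (chosen realising ideles,
  analytic logarithms, SHARP boxes; any columns, any `qK`): row 16's door with no residual hypothesis, the exact analogue of rows 8 / 18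
  (`pilotKummerCompatHull_chosen_of_hBand`, `…_of_inSigma18`).
* `abc_of_inSigma16_v10K_window_szpiroBadAll` — the re-cut certificate of the record's shape at `InSig := ∃ e_K B_K, InSigma16 T.D e_K B_K`: explicit 3 =
  Σ₁₆(window ∧ Szpiro-bad) · NUM(deep ∧ Szpiro-bad) · CONE(Szpiro-bad), through the companion's generic `abc_of_inSigma_v10K_window_szpiroBadAll` ∘
  abc-iut-s2-p2's `Conditional.abc_of_SH_v10K_window_szpiroBadAll` (p453137). NO binder is kernel-refuted (contrast the blanket `hreg` of the gen-0 record
  `abc_of_sigma16_v10K_window_szpiroBadBoth`, refuted by `Conditional.not_hreg_v4` — that record is vacuous as typed).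

HONEST SCOPE: whether the shallow Szpiro-bad admissible data lie in Σ₁₆ for `l` in print's window is Q3 (rh2-q3-num), not claimed; off Σ₁₆ (wild or tied
bad fibres) nothing is said here; `hNumBad` / `hregBad` are assumption labels; «`ABC` follows from these hypotheses AS TYPED», nothing more. no side taken
on [IUTchIII] Cor. 3.12; typed ≠ proved; refuted-as-typed ≠ refuted-in-print. [claim: Mochizuki2012, status: disputed]
[cite: Mochizuki2012, IUTchI Def. 3.1 (b) p. 61, Ex. 3.2 (iv) p. 71; IUTchIII Cor. 3.12 p. 173–174, Step (xi-f) p. 184; IUTchIV Prop. 1.1 p. 9, Thm. 1.10 p. 22–31]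
[cite: DupuyHilado2025, §3.9, §4.9]
-/

noncomputable section

open Set Function
open scoped Pointwise
namespace Summit.ABC.IUTFork.Repair.RH2SigmaHull

open Thm311 Thm311.Real Cor312 Cor312.Setting Cor312Vol Cor312Prov Literature.IUT.LogThetaLattice Literature.IUT.LogVolume
  Literature.IUT.HodgeTheaters Literature.IUT.LogVolume.ThetaData
open Literature.NumberTheory.NumberFields NumberField IsDedekindDomain Metric RHSlotReach RH RH.InSigmaDatum
open Literature.NumberTheory.DiophantineGeometry.GenEll Summit.ABC.ABC.Theorems

/-! ## §1. The door: `InSigma16` alone ⟹ the hSHw body at the certificates' bed -/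

section Genuine

variable {F K Fbar : Type} [Field F] [NumberField F] [Field K] [NumberField K] [Algebra F K] [Field Fbar]
  [Algebra F Fbar] [Algebra K Fbar] {E : WeierstrassCurve F} [E.IsElliptic] {l : ℕ} {Pb : BadPlacePredicates K}
  (D : InitialThetaData F K Fbar E l Pb)
variable (M : Type) [Field M] [NumberField M]
  (archPk : ∀ (j : (thetaIndex (pilotDataOfK D K)).Label) (vQ : (thetaIndex (pilotDataOfK D K)).VQ),
    Set ((logShellsDH (pilotDataOfK D K) (analyticLogv K)).Packet j vQ))
  (archSub : ∀ (j : (thetaIndex (pilotDataOfK D K)).Label) (v : (thetaIndex (pilotDataOfK D K)).V),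
    Set ((logShellsDH (pilotDataOfK D K) (analyticLogv K)).Packet j ((thetaIndex (pilotDataOfK D K)).over v)))
  (Ψ : ℤ → ∀ v : (thetaIndex (pilotDataOfK D K)).V, v ∈ (thetaIndex (pilotDataOfK D K)).Vbad →
    Set ((logShellsDH (pilotDataOfK D K) (analyticLogv K)).StarPacket v))
  (act : ℤ → ∀ v : (thetaIndex (pilotDataOfK D K)).V, v ∈ (thetaIndex (pilotDataOfK D K)).Vbad →
    (logShellsDH (pilotDataOfK D K) (analyticLogv K)).StarPacket v →
      Module.End ℚ ((logShellsDH (pilotDataOfK D K) (analyticLogv K)).StarPacket v))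
  (Mmod : ℤ → ∀ j : (thetaIndex (pilotDataOfK D K)).LabelStar, Set ((logShellsDH (pilotDataOfK D K) (analyticLogv K)).GlobalPacket j.1))
  (region : ℤ → ∀ j : (thetaIndex (pilotDataOfK D K)).LabelStar, FinDivisor M → ∀ vQ : (thetaIndex (pilotDataOfK D K)).VQ,
    Set ((logShellsDH (pilotDataOfK D K) (analyticLogv K)).Packet j.1 vQ))
  (frobAdm : ℤ → ℤ → ∀ (j : (thetaIndex (pilotDataOfK D K)).Label) (vQ : (thetaIndex (pilotDataOfK D K)).VQ),
    Set ((logShellsDH (pilotDataOfK D K) (analyticLogv K)).Packet j vQ) → Prop)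
  (frobLogvol : ℤ → ℤ → ∀ (j : (thetaIndex (pilotDataOfK D K)).Label) (vQ : (thetaIndex (pilotDataOfK D K)).VQ),
    Set ((logShellsDH (pilotDataOfK D K) (analyticLogv K)).Packet j vQ) → ℝ)
  (frobΨ : ℤ → ℤ → ∀ v : (thetaIndex (pilotDataOfK D K)).V, v ∈ (thetaIndex (pilotDataOfK D K)).Vbad →
    Set ((logShellsDH (pilotDataOfK D K) (analyticLogv K)).StarPacket v))
  (frobMmod : ℤ → ℤ → ∀ j : (thetaIndex (pilotDataOfK D K)).LabelStar,
    Set ((logShellsDH (pilotDataOfK D K) (analyticLogv K)).GlobalPacket j.1))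
  (unitImage : ℤ → ℤ → ℕ → ∀ (j : (thetaIndex (pilotDataOfK D K)).Label) (vQ : (thetaIndex (pilotDataOfK D K)).VQ),
    Set ((logShellsDH (pilotDataOfK D K) (analyticLogv K)).Packet j vQ))
  (ballImage : ℤ → ℤ → ∀ (j : (thetaIndex (pilotDataOfK D K)).Label) (vQ : (thetaIndex (pilotDataOfK D K)).VQ),
    Set ((logShellsDH (pilotDataOfK D K) (analyticLogv K)).Packet j vQ))
  (thetaDiv : ℤ → ℤ → LgpDivisor M (thetaIndex (pilotDataOfK D K)).lstar)
  (n : ℤ) {HT : Type} {LogLink : HT → HT → Type} {IsFull : ∀ {s t : HT}, LogLink s t → Prop}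
  (lat : LGPGaussianLogThetaLattice LogLink IsFull)
  {Frd : Type} {IsoF : Frd → Frd → Type} {Ob : Frd → Type} {realify : Frd → Frd} {Strip : Type}
  {IsoS : Strip → Strip → Type}
  {Mv : ∀ v : (thetaIndex (pilotDataOfK D K)).V, v ∈ (thetaIndex (pilotDataOfK D K)).Vbad → Type} [∀ v h, Monoid (Mv v h)]
  (sig : GlobalLGPFrobenioidSignature (thetaIndex (pilotDataOfK D K)).lstar (thetaIndex (pilotDataOfK D K)).V
    (· ∈ (thetaIndex (pilotDataOfK D K)).Vbad) Frd IsoF Ob realify Strip IsoS Mv)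
  (split : SplittingMonoids Mv) {ObΔ : Type}
  {N : ∀ v : (thetaIndex (pilotDataOfK D K)).V, v ∈ (thetaIndex (pilotDataOfK D K)).Vbad → Type} [∀ v h, Monoid (N v h)]
  (qData : QPilotData ObΔ N)
  (qK : ∀ v : (thetaIndex (pilotDataOfK D K)).V, v ∈ (thetaIndex (pilotDataOfK D K)).Vbad →
    Set ((logShellsDH (pilotDataOfK D K) (analyticLogv K)).StarPacket v))

/-- **ROW 16 AT THE CERTIFICATES' BED, NO RESIDUAL HYPOTHESIS: `InSigma16 D e_K B_K` (abc-iut-rh2-xi-2, p475213) ALONE ⟹ the BODY of `hSHw`**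
(CHOSEN realising ideles, analytic logarithms; any column binders, any `qK`). = `pilotKummerCompatHull_chosen_of_hStarDiffPriced` (p472572) fed with
`InSigmaDatum.hside_of_inSigma16` and `InSigmaDatum.hStarDiffPriced_of_inSigma16`; the one extra input of the former, «bad primes odd», is the THEOREM
`Cor312Prov.ne_two_and_ne_l_of_placeOf_mem_S_pilotDataOfK` ([IUTchI] Def. 3.1 (b)) at the genuine bed. [cite: Mochizuki2012, IUTchI Def. 3.1 (b) p. 61,
Ex. 3.2 (iv) p. 71] [cite: DupuyHilado2025, §3.9, §4.9] [claim: Mochizuki2012, status: disputed] -/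
theorem pilotKummerCompatHull_chosen_of_inSigma16 {eK : Nat.Primes → ℕ} {BK : Nat.Primes → ℤ} (h : InSigma16 D eK BK) :
    PilotKummerCompatHull
      (LatticeSituation.ofShells (logShellsDH (pilotDataOfK D K) (analyticLogv K)) M archPk archSub
        (summandPiecesPr (pilotDataOfK D K) (logvAnalytic_analyticLogv (F := K))).Adm
        (summandPiecesPr (pilotDataOfK D K) (logvAnalytic_analyticLogv (F := K))).logvol Ψ act Mmod region frobAdm frobLogvol frobΨ
        frobMmod unitImage ballImage thetaDiv)
      (settingPrVolSharp (pilotDataOfK D K) (logvAnalytic_analyticLogv (F := K)) M archPk archSub Ψ act Mmod region n lat sig split qData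
        (exists_realising_qIdeles_pilotDataOfK D).choose (exists_realising_thetaIdeles_pilotDataOfK D).choose
        (exists_realising_qIdeles_pilotDataOfK D).choose_spec.1 (exists_realising_qIdeles_pilotDataOfK D).choose_spec.2.1)
      (fun _ => (settingPrVolSharp (pilotDataOfK D K) (logvAnalytic_analyticLogv (F := K)) M archPk archSub Ψ act Mmod region n lat sig
        split qData (exists_realising_qIdeles_pilotDataOfK D).choose (exists_realising_thetaIdeles_pilotDataOfK D).choose
        (exists_realising_qIdeles_pilotDataOfK D).choose_spec.1 (exists_realising_qIdeles_pilotDataOfK D).choose_spec.2.1).qRegion)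
      qK :=
  pilotKummerCompatHull_chosen_of_hStarDiffPriced D M archPk archSub Ψ act Mmod region frobAdm frobLogvol frobΨ frobMmod unitImage ballImage
    thetaDiv n lat sig split qData qK
    (hside_of_inSigma16 D h fun pp w hw =>
      lt_of_le_of_ne pp.2.two_le (Ne.symm (ne_two_and_ne_l_of_placeOf_mem_S_pilotDataOfK D pp w hw).1))
    (hStarDiffPriced_of_inSigma16 D h)

end Genuine

/-! ## §2. The re-cut certificate for Σ₁₆ := `InSigma16` -/

section Certificate
variable
    (M : ∀ (P : NFPoint) (l : ℕ) (T : Cor22.ThetaVolumeDatumAt P l), Type) [∀ P l T, Field (M P l T)] [∀ P l T, NumberField (M P l T)]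
    (archPk : ∀ (P : NFPoint) (l : ℕ) (T : Cor22.ThetaVolumeDatumAt P l), letI := T.instFieldF; letI := T.instNumberFieldF; letI := T.instAlgebraF; letI := T.instFieldK;
        letI := T.instNumberFieldK; letI := T.instAlgebraK; letI := T.instFieldFbar; letI := T.instAlgebraFbar;
        letI := T.instAlgebraKFbar; letI := T.instIsElliptic;
      ∀ (j : (thetaIndex (pilotDataOfK T.D T.K)).Label) (vQ : (thetaIndex (pilotDataOfK T.D T.K)).VQ), Set ((logShellsDH (pilotDataOfK T.D T.K) (analyticLogv T.K)).Packet j vQ))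
    (archSub : ∀ (P : NFPoint) (l : ℕ) (T : Cor22.ThetaVolumeDatumAt P l), letI := T.instFieldF; letI := T.instNumberFieldF; letI := T.instAlgebraF; letI := T.instFieldK;
        letI := T.instNumberFieldK; letI := T.instAlgebraK; letI := T.instFieldFbar; letI := T.instAlgebraFbar;
        letI := T.instAlgebraKFbar; letI := T.instIsElliptic;
      ∀ (j : (thetaIndex (pilotDataOfK T.D T.K)).Label) (v : (thetaIndex (pilotDataOfK T.D T.K)).V), Set ((logShellsDH (pilotDataOfK T.D T.K) (analyticLogv T.K)).Packet j ((thetaIndex (pilotDataOfK T.D T.K)).over v)))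
    (Ψ : ∀ (P : NFPoint) (l : ℕ) (T : Cor22.ThetaVolumeDatumAt P l), letI := T.instFieldF; letI := T.instNumberFieldF; letI := T.instAlgebraF; letI := T.instFieldK;
        letI := T.instNumberFieldK; letI := T.instAlgebraK; letI := T.instFieldFbar; letI := T.instAlgebraFbar;
        letI := T.instAlgebraKFbar; letI := T.instIsElliptic;
      ℤ → ∀ v : (thetaIndex (pilotDataOfK T.D T.K)).V, v ∈ (thetaIndex (pilotDataOfK T.D T.K)).Vbad → Set ((logShellsDH (pilotDataOfK T.D T.K) (analyticLogv T.K)).StarPacket v))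
    (act : ∀ (P : NFPoint) (l : ℕ) (T : Cor22.ThetaVolumeDatumAt P l), letI := T.instFieldF; letI := T.instNumberFieldF; letI := T.instAlgebraF; letI := T.instFieldK;
        letI := T.instNumberFieldK; letI := T.instAlgebraK; letI := T.instFieldFbar; letI := T.instAlgebraFbar;
        letI := T.instAlgebraKFbar; letI := T.instIsElliptic;
      ℤ → ∀ v : (thetaIndex (pilotDataOfK T.D T.K)).V, v ∈ (thetaIndex (pilotDataOfK T.D T.K)).Vbad → (logShellsDH (pilotDataOfK T.D T.K) (analyticLogv T.K)).StarPacket v → Module.End ℚ ((logShellsDH (pilotDataOfK T.D T.K) (analyticLogv T.K)).StarPacket v))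
    (Mmod : ∀ (P : NFPoint) (l : ℕ) (T : Cor22.ThetaVolumeDatumAt P l), letI := T.instFieldF; letI := T.instNumberFieldF; letI := T.instAlgebraF; letI := T.instFieldK;
        letI := T.instNumberFieldK; letI := T.instAlgebraK; letI := T.instFieldFbar; letI := T.instAlgebraFbar;
        letI := T.instAlgebraKFbar; letI := T.instIsElliptic;
      ℤ → ∀ j : (thetaIndex (pilotDataOfK T.D T.K)).LabelStar, Set ((logShellsDH (pilotDataOfK T.D T.K) (analyticLogv T.K)).GlobalPacket j.1))
    (region : ∀ (P : NFPoint) (l : ℕ) (T : Cor22.ThetaVolumeDatumAt P l), letI := T.instFieldF; letI := T.instNumberFieldF; letI := T.instAlgebraF; letI := T.instFieldK;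
        letI := T.instNumberFieldK; letI := T.instAlgebraK; letI := T.instFieldFbar; letI := T.instAlgebraFbar;
        letI := T.instAlgebraKFbar; letI := T.instIsElliptic;
      ℤ → ∀ j : (thetaIndex (pilotDataOfK T.D T.K)).LabelStar, FinDivisor (M P l T) → ∀ vQ : (thetaIndex (pilotDataOfK T.D T.K)).VQ, Set ((logShellsDH (pilotDataOfK T.D T.K) (analyticLogv T.K)).Packet j.1 vQ))
    (frobAdm : ∀ (P : NFPoint) (l : ℕ) (T : Cor22.ThetaVolumeDatumAt P l), letI := T.instFieldF; letI := T.instNumberFieldF; letI := T.instAlgebraF; letI := T.instFieldK;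
        letI := T.instNumberFieldK; letI := T.instAlgebraK; letI := T.instFieldFbar; letI := T.instAlgebraFbar;
        letI := T.instAlgebraKFbar; letI := T.instIsElliptic;
      ℤ → ℤ → ∀ (j : (thetaIndex (pilotDataOfK T.D T.K)).Label) (vQ : (thetaIndex (pilotDataOfK T.D T.K)).VQ), Set ((logShellsDH (pilotDataOfK T.D T.K) (analyticLogv T.K)).Packet j vQ) → Prop)
    (frobLogvol : ∀ (P : NFPoint) (l : ℕ) (T : Cor22.ThetaVolumeDatumAt P l), letI := T.instFieldF; letI := T.instNumberFieldF; letI := T.instAlgebraF; letI := T.instFieldK;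
        letI := T.instNumberFieldK; letI := T.instAlgebraK; letI := T.instFieldFbar; letI := T.instAlgebraFbar;
        letI := T.instAlgebraKFbar; letI := T.instIsElliptic;
      ℤ → ℤ → ∀ (j : (thetaIndex (pilotDataOfK T.D T.K)).Label) (vQ : (thetaIndex (pilotDataOfK T.D T.K)).VQ), Set ((logShellsDH (pilotDataOfK T.D T.K) (analyticLogv T.K)).Packet j vQ) → ℝ)
    (frobΨ : ∀ (P : NFPoint) (l : ℕ) (T : Cor22.ThetaVolumeDatumAt P l), letI := T.instFieldF; letI := T.instNumberFieldF; letI := T.instAlgebraF; letI := T.instFieldK;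
        letI := T.instNumberFieldK; letI := T.instAlgebraK; letI := T.instFieldFbar; letI := T.instAlgebraFbar;
        letI := T.instAlgebraKFbar; letI := T.instIsElliptic;
      ℤ → ℤ → ∀ v : (thetaIndex (pilotDataOfK T.D T.K)).V, v ∈ (thetaIndex (pilotDataOfK T.D T.K)).Vbad → Set ((logShellsDH (pilotDataOfK T.D T.K) (analyticLogv T.K)).StarPacket v))
    (frobMmod : ∀ (P : NFPoint) (l : ℕ) (T : Cor22.ThetaVolumeDatumAt P l), letI := T.instFieldF; letI := T.instNumberFieldF; letI := T.instAlgebraF; letI := T.instFieldK;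
        letI := T.instNumberFieldK; letI := T.instAlgebraK; letI := T.instFieldFbar; letI := T.instAlgebraFbar;
        letI := T.instAlgebraKFbar; letI := T.instIsElliptic;
      ℤ → ℤ → ∀ j : (thetaIndex (pilotDataOfK T.D T.K)).LabelStar, Set ((logShellsDH (pilotDataOfK T.D T.K) (analyticLogv T.K)).GlobalPacket j.1))
    (unitImage : ∀ (P : NFPoint) (l : ℕ) (T : Cor22.ThetaVolumeDatumAt P l), letI := T.instFieldF; letI := T.instNumberFieldF; letI := T.instAlgebraF; letI := T.instFieldK;
        letI := T.instNumberFieldK; letI := T.instAlgebraK; letI := T.instFieldFbar; letI := T.instAlgebraFbar;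
        letI := T.instAlgebraKFbar; letI := T.instIsElliptic;
      ℤ → ℤ → ℕ → ∀ (j : (thetaIndex (pilotDataOfK T.D T.K)).Label) (vQ : (thetaIndex (pilotDataOfK T.D T.K)).VQ), Set ((logShellsDH (pilotDataOfK T.D T.K) (analyticLogv T.K)).Packet j vQ))
    (ballImage : ∀ (P : NFPoint) (l : ℕ) (T : Cor22.ThetaVolumeDatumAt P l), letI := T.instFieldF; letI := T.instNumberFieldF; letI := T.instAlgebraF; letI := T.instFieldK;
        letI := T.instNumberFieldK; letI := T.instAlgebraK; letI := T.instFieldFbar; letI := T.instAlgebraFbar;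
        letI := T.instAlgebraKFbar; letI := T.instIsElliptic;
      ℤ → ℤ → ∀ (j : (thetaIndex (pilotDataOfK T.D T.K)).Label) (vQ : (thetaIndex (pilotDataOfK T.D T.K)).VQ), Set ((logShellsDH (pilotDataOfK T.D T.K) (analyticLogv T.K)).Packet j vQ))
    (thetaDiv : ∀ (P : NFPoint) (l : ℕ) (T : Cor22.ThetaVolumeDatumAt P l), letI := T.instFieldF; letI := T.instNumberFieldF; letI := T.instAlgebraF; letI := T.instFieldK;
        letI := T.instNumberFieldK; letI := T.instAlgebraK; letI := T.instFieldFbar; letI := T.instAlgebraFbar;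
        letI := T.instAlgebraKFbar; letI := T.instIsElliptic;
      ℤ → ℤ → LgpDivisor (M P l T) (thetaIndex (pilotDataOfK T.D T.K)).lstar)
    (n : ∀ (P : NFPoint) (l : ℕ) (T : Cor22.ThetaVolumeDatumAt P l), ℤ)
    {HT : ∀ (P : NFPoint) (l : ℕ) (T : Cor22.ThetaVolumeDatumAt P l), Type} {LogLink : ∀ (P : NFPoint) (l : ℕ) (T : Cor22.ThetaVolumeDatumAt P l), HT P l T → HT P l T → Type}
    {IsFull : ∀ (P : NFPoint) (l : ℕ) (T : Cor22.ThetaVolumeDatumAt P l), ∀ {s t : HT P l T}, LogLink P l T s t → Prop}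
    (lat : ∀ (P : NFPoint) (l : ℕ) (T : Cor22.ThetaVolumeDatumAt P l), LGPGaussianLogThetaLattice (LogLink P l T) (IsFull P l T))
    {Frd : ∀ (P : NFPoint) (l : ℕ) (T : Cor22.ThetaVolumeDatumAt P l), Type} {IsoF : ∀ (P : NFPoint) (l : ℕ) (T : Cor22.ThetaVolumeDatumAt P l), Frd P l T → Frd P l T → Type} {Ob : ∀ (P : NFPoint) (l : ℕ) (T : Cor22.ThetaVolumeDatumAt P l), Frd P l T → Type}
    {realify : ∀ (P : NFPoint) (l : ℕ) (T : Cor22.ThetaVolumeDatumAt P l), Frd P l T → Frd P l T} {Strip : ∀ (P : NFPoint) (l : ℕ) (T : Cor22.ThetaVolumeDatumAt P l), Type} {IsoS : ∀ (P : NFPoint) (l : ℕ) (T : Cor22.ThetaVolumeDatumAt P l), Strip P l T → Strip P l T → Type}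
    {Mv : ∀ (P : NFPoint) (l : ℕ) (T : Cor22.ThetaVolumeDatumAt P l), letI := T.instFieldF; letI := T.instNumberFieldF; letI := T.instAlgebraF; letI := T.instFieldK;
        letI := T.instNumberFieldK; letI := T.instAlgebraK; letI := T.instFieldFbar; letI := T.instAlgebraFbar;
        letI := T.instAlgebraKFbar; letI := T.instIsElliptic;
      ∀ v : (thetaIndex (pilotDataOfK T.D T.K)).V, v ∈ (thetaIndex (pilotDataOfK T.D T.K)).Vbad → Type}
    [∀ P l T v h, Monoid (Mv P l T v h)]
    (sig : ∀ (P : NFPoint) (l : ℕ) (T : Cor22.ThetaVolumeDatumAt P l), letI := T.instFieldF; letI := T.instNumberFieldF; letI := T.instAlgebraF; letI := T.instFieldK;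
        letI := T.instNumberFieldK; letI := T.instAlgebraK; letI := T.instFieldFbar; letI := T.instAlgebraFbar;
        letI := T.instAlgebraKFbar; letI := T.instIsElliptic;
      GlobalLGPFrobenioidSignature (thetaIndex (pilotDataOfK T.D T.K)).lstar (thetaIndex (pilotDataOfK T.D T.K)).V (· ∈ (thetaIndex (pilotDataOfK T.D T.K)).Vbad) (Frd P l T) (IsoF P l T) (Ob P l T) (realify P l T)
        (Strip P l T) (IsoS P l T) (Mv P l T))
    (split : ∀ (P : NFPoint) (l : ℕ) (T : Cor22.ThetaVolumeDatumAt P l), SplittingMonoids (Mv P l T))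
    {ObΔ : ∀ (P : NFPoint) (l : ℕ) (T : Cor22.ThetaVolumeDatumAt P l), Type} {N : ∀ (P : NFPoint) (l : ℕ) (T : Cor22.ThetaVolumeDatumAt P l), letI := T.instFieldF; letI := T.instNumberFieldF; letI := T.instAlgebraF; letI := T.instFieldK;
        letI := T.instNumberFieldK; letI := T.instAlgebraK; letI := T.instFieldFbar; letI := T.instAlgebraFbar;
        letI := T.instAlgebraKFbar; letI := T.instIsElliptic;
      ∀ v : (thetaIndex (pilotDataOfK T.D T.K)).V, v ∈ (thetaIndex (pilotDataOfK T.D T.K)).Vbad → Type}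
    [∀ P l T v h, Monoid (N P l T v h)] (qData : ∀ (P : NFPoint) (l : ℕ) (T : Cor22.ThetaVolumeDatumAt P l), QPilotData (ObΔ P l T) (N P l T))
    (qK : ∀ (P : NFPoint) (l : ℕ) (T : Cor22.ThetaVolumeDatumAt P l), letI := T.instFieldF; letI := T.instNumberFieldF; letI := T.instAlgebraF; letI := T.instFieldK;
        letI := T.instNumberFieldK; letI := T.instAlgebraK; letI := T.instFieldFbar; letI := T.instAlgebraFbar;
        letI := T.instAlgebraKFbar; letI := T.instIsElliptic;
      ∀ v : (thetaIndex (pilotDataOfK T.D T.K)).V, v ∈ (thetaIndex (pilotDataOfK T.D T.K)).Vbad → Set ((logShellsDH (pilotDataOfK T.D T.K) (analyticLogv T.K)).StarPacket v))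

include M archPk archSub Ψ act Mmod region frobAdm frobLogvol frobΨ frobMmod unitImage ballImage thetaDiv n lat sig split qData qK

/-- **`abc_of_inSigma16_v10K_window_szpiroBadAll` — row 16 BY NAME of `InSigma16`, re-cut.** The companion's generic
`abc_of_inSigma_v10K_window_szpiroBadAll` at `InSig := ∃ e_K B_K, InSigma16 T.D e_K B_K` (abc-iut-rh2-xi-2 p475213), door §1. Explicit 3 = Σ₁₆(window ∧
Szpiro-bad) «every shallow admissible datum of a Szpiro-bad point lies in Σ₁₆» · NUM(deep ∧ Szpiro-bad) `hNumBad` · CONE(Szpiro-bad) `hregBad` (p453137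
VERBATIM); binder status: the WARNING below; supersedes the vacuous-as-typed gen-0 record `abc_of_sigma16_v10K_window_szpiroBadBoth` (blanket `hreg`,
`Conditional.not_hreg_v4`) and drops p476057's residual side conditions into the datum class. «`ABC` follows from these hypotheses AS TYPED», nothing more;
no side taken on [IUTchIII] Cor. 3.12; `InSigma16` is a HYPOTHESIS SHAPE; typed ≠ proved. [claim: Mochizuki2012, status: disputed]
[cite: Mochizuki2012, IUTchIII Cor. 3.12 p. 173–174, Step (xi-f) p. 184; IUTchIV Thm. 1.10 p. 22–23] [cite: DupuyHilado2025, §3.9, §4.9]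
**WARNING (abc-iut-rh2-q2-hull gen 3, after referee abc-iut-rp-m1's kernel caveat of 2026-08-27): VACUOUS AS TYPED.** The binder `hInSigma16Bad` below is
KERNEL-FALSE — `RH2SigmaHull.not_hInSigma16Bad` (`Repair/RH2SigmaHullSigmaBinderRefute.lean`; every genuine datum over the admissible Szpiro-bad tier-1
Frey–Legendre point `(ratPoint λ₃₆₇₇, 13)` is shallow and OFF Σ₁₆, unconditionally since `Conditional.condP6_thirteen`) — so this implication, though kernel-true,
can never be discharged. Successor shape: `abc_of_inSigma_orNum_K_szpiroBad_hregBad` (explicit 2 = NUM-OFF-Σ(Szpiro-bad) · CONE(Szpiro-bad)); kept as a record. -/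
theorem abc_of_inSigma16_v10K_window_szpiroBadAll
    -- [Σ₁₆, WINDOW ∧ SZPIRO-BAD] `InSigma16` at the genuine bed of every admissible datum off the depth locus of a Szpiro-bad point
    (hInSigma16Bad : ∀ (P : NFPoint), P ∈ UP → ∀ (l : ℕ), l.Prime → 5 ≤ l →
      Cor22.AdmitsCore P → Cor22.CondP2 P l → Cor22.CondP5 P l → Cor22.CondP6 P l →
      -- ONLY at SZPIRO-BAD `(P, l)`: elsewhere `T.Cor312Of` is the theorem `Cor22.ThetaVolumeDatumAt.cor312Of_of_szpiro` (abc-iut-c312-d1)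
      (((l : ℝ) + 5) / 4 < (Cor22.dmod P : ℝ) ∨
        6 * l * (((l : ℝ) + 5) - 4 * Cor22.dmod P) / (((l : ℝ) + 4) * ((l : ℝ) - 3))
            * (P.logDiff + (1 - 1 / (l : ℝ)) * Cor22.logCondAvoid P {2, l})
          + 6 * l * ((l : ℝ) + 5) / (((l : ℝ) + 4) * ((l : ℝ) - 3)) * Real.log Real.pi < Cor22.logQAvoid P {2, l}) →
      ∀ (T : Cor22.ThetaVolumeDatumAt P l), letI := T.instFieldF; letI := T.instNumberFieldF; letI := T.instAlgebraF; letI := T.instFieldK;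
        letI := T.instNumberFieldK; letI := T.instAlgebraK; letI := T.instFieldFbar; letI := T.instAlgebraFbar;
        letI := T.instAlgebraKFbar; letI := T.instIsElliptic;
      ¬ (∃ (pp : Nat.Primes) (_ : 2 < (pp : ℕ)) (i : Fin (thetaIndex (pilotDataOfK T.D T.K)).lstar)
          (x₀ : (thetaIndex (pilotDataOfK T.D T.K)).Fibre (.inr pp)),
        haveI : Fact (pp : ℕ).Prime := ⟨pp.2⟩
        ((pp : ℕ) : ℝ) ^ ((((i : ℕ) : ℝ) + 2) * (4 + 2 * Real.logb (pp : ℕ) (Module.finrank ℚ T.K)) + 1) *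
          ‖(exists_realising_qIdeles_pilotDataOfK T.D).choose pp x₀‖ ^ (((i : ℕ) + 1) ^ 2 - 1) < 1) →
      ∃ (eK : Nat.Primes → ℕ) (BK : Nat.Primes → ℤ), InSigma16 T.D eK BK)
    (hNumBad : ∀ (P : NFPoint), P ∈ UP → ∀ (l : ℕ), l.Prime → 5 ≤ l →
      Cor22.AdmitsCore P → Cor22.CondP2 P l → Cor22.CondP5 P l → Cor22.CondP6 P l →
      -- ONLY at SZPIRO-BAD `(P, l)`: elsewhere `T.Cor312Of` is the theorem `Cor22.ThetaVolumeDatumAt.cor312Of_of_szpiro` (abc-iut-c312-d1)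
      (((l : ℝ) + 5) / 4 < (Cor22.dmod P : ℝ) ∨
        6 * l * (((l : ℝ) + 5) - 4 * Cor22.dmod P) / (((l : ℝ) + 4) * ((l : ℝ) - 3))
            * (P.logDiff + (1 - 1 / (l : ℝ)) * Cor22.logCondAvoid P {2, l})
          + 6 * l * ((l : ℝ) + 5) / (((l : ℝ) + 4) * ((l : ℝ) - 3)) * Real.log Real.pi < Cor22.logQAvoid P {2, l}) →
      ∀ (T : Cor22.ThetaVolumeDatumAt P l), letI := T.instFieldF; letI := T.instNumberFieldF; letI := T.instAlgebraF; letI := T.instFieldK;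
        letI := T.instNumberFieldK; letI := T.instAlgebraK; letI := T.instFieldFbar; letI := T.instAlgebraFbar;
        letI := T.instAlgebraKFbar; letI := T.instIsElliptic;
      (∃ (pp : Nat.Primes) (_ : 2 < (pp : ℕ)) (i : Fin (thetaIndex (pilotDataOfK T.D T.K)).lstar)
          (x₀ : (thetaIndex (pilotDataOfK T.D T.K)).Fibre (.inr pp)),
        haveI : Fact (pp : ℕ).Prime := ⟨pp.2⟩
        ((pp : ℕ) : ℝ) ^ ((((i : ℕ) : ℝ) + 2) * (4 + 2 * Real.logb (pp : ℕ) (Module.finrank ℚ T.K)) + 1) *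
          ‖(exists_realising_qIdeles_pilotDataOfK T.D).choose pp x₀‖ ^ (((i : ℕ) + 1) ^ 2 - 1) < 1) → T.Cor312Of)
    -- [CONE, SZPIRO-BAD] the hull estimate with print's `B_III(P,l)` off the slot-constant regime, ONLY at SZPIRO-BAD admissible points (C-R28 (3)(α))
    (hregBad : ∀ P : NFPoint, P ∈ UP → ∀ l : ℕ, l.Prime → 5 ≤ l →
      Cor22.AdmitsCore P → Cor22.CondP2 P l → Cor22.CondP5 P l → Cor22.CondP6 P l →
      (((l : ℝ) + 5) / 4 < (Cor22.dmod P : ℝ) ∨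
        6 * l * (((l : ℝ) + 5) - 4 * Cor22.dmod P) / (((l : ℝ) + 4) * ((l : ℝ) - 3))
            * (P.logDiff + (1 - 1 / (l : ℝ)) * Cor22.logCondAvoid P {2, l})
          + 6 * l * ((l : ℝ) + 5) / (((l : ℝ) + 4) * ((l : ℝ) - 3)) * Real.log Real.pi < Cor22.logQAvoid P {2, l}) →
      ∀ T : Cor22.ThetaVolumeDatumAt P l,
        (letI := T.instFieldF; letI := T.instNumberFieldF; letI := T.instAlgebraF; letI := T.instFieldK
         letI := T.instNumberFieldK; letI := T.instAlgebraK; letI := T.instFieldFbar; letI := T.instAlgebraFbar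
         letI := T.instAlgebraKFbar; letI := T.instIsElliptic
         ¬ (∀ p ∈ T.I.supportPrimes, ∀ v w : placesOver (fieldOfModuli T.E) p,
            (Summit.ABC.IUTFork.DHData.ofInput T.I).logQloc p v = (Summit.ABC.IUTFork.DHData.ofInput T.I).logQloc p w)) →
        T.HullEstimateOf
          (((l : ℝ) + 1) / 4 *
            ((1 + 12 * (Cor22.dmod P : ℝ) / l) * (P.logDiff + Cor22.logCondAvoid P {2, l})
              + 2 * Real.log l + 52
              + 20 / 3 * Real.log (((2 ^ 12 * 3 ^ 3 * 5 * Cor22.dmod P : ℕ) : ℝ) * (l : ℝ))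
                * (Nat.primeCounting (2 ^ 12 * 3 ^ 3 * 5 * Cor22.dmod P * l) : ℝ))))
    : _root_.ABC :=
  abc_of_inSigma_v10K_window_szpiroBadAll (M := M) (archPk := archPk) (archSub := archSub) (Ψ := Ψ) (act := act) (Mmod := Mmod)
    (region := region) (frobAdm := frobAdm) (frobLogvol := frobLogvol) (frobΨ := frobΨ) (frobMmod := frobMmod) (unitImage := unitImage)
    (ballImage := ballImage) (thetaDiv := thetaDiv) (n := n) (lat := lat) (sig := sig) (split := split) (qData := qData) (qK := qK)
    (hNumBad := hNumBad) (hregBad := hregBad) (hSigmaBad := hInSigma16Bad)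
    (hdoor := fun P l T h => by
      letI := T.instFieldF; letI := T.instNumberFieldF; letI := T.instAlgebraF; letI := T.instFieldK
      letI := T.instNumberFieldK; letI := T.instAlgebraK; letI := T.instFieldFbar; letI := T.instAlgebraFbar
      letI := T.instAlgebraKFbar; letI := T.instIsElliptic
      obtain ⟨eK, BK, h⟩ := h
      exact pilotKummerCompatHull_chosen_of_inSigma16 T.D (M P l T) (archPk P l T) (archSub P l T) (Ψ P l T) (act P l T)
        (Mmod P l T) (region P l T) (frobAdm P l T) (frobLogvol P l T) (frobΨ P l T) (frobMmod P l T) (unitImage P l T) (ballImage P l T)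
        (thetaDiv P l T) (n P l T) (lat P l T) (sig P l T) (split P l T) (qData P l T) (qK P l T) h)

end Certificate

end Summit.ABC.IUTFork.Repair.RH2SigmaHull

end
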